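import Mathlib.Geometry.Manifold.Riemannian.Basic
import Mathlib.MeasureTheory.Measure.Hausdorff
import Mathlib.MeasureTheory.Measure.Lebesgue.EqHaar
import Literature.Geometry.Lorentzian.Volume
import Literature.Geometry.Lorentzian.VolumePositivity
import Literature.Geometry.Lorentzian.VolumeProofs
import HarnessLib

/-!
# Small geodesic balls have volume at least `c · rⁿ`

Companion of `Volume.lean` / `VolumePositivity.lean` / `VolumeProofs.lean`. For the Riemannian
length (e)metric `d = riemannianEDist` of a continuous Riemannian metric on a boundaryless `C¹`
manifold `M` of dimension `n = dim E` we prove the **Euclidean lower volume bound for small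
balls**:

* `exists_nhds_mul_pow_le_hausdorffMeasure_eball` — around every point `x` there are `c > 0`,
  `ρ > 0` and a neighbourhood `V` of `x` such that `c · rⁿ ≤ μH[n] (B_d(p, r))` for all `p ∈ V`
  and all `0 < r ≤ ρ` (locally uniform version of `lim_{r→0} Vol B(p,r) / (ω_n rⁿ) = 1`, with a
  non-sharp constant);
* `exists_mul_pow_le_hausdorffMeasure_eball_of_isCompact` — on a compact subset `K` (e.g. a closed
  manifold) and for every `R`, one constant works for all centres `p ∈ K` and all radii
  `0 < r ≤ R`;
* `exists_mul_pow_le_riemannianVolume_of_compactSpace`, `exists_nhds_mul_pow_le_riemannianVolume`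
  — the same for the Riemannian volume `riemannianVolume h (dim E)` (= `riemannianMeasure h`) of a
  `C^k` Riemannian metric `h` in the sense of `Volume.lean`, balls being the sets
  `{y | d_h(p, y) < r}` of the length distance.

This is the elementary half ("the metric is smooth, so `r⁻ⁿ V(p, r) → ω_n` as `r ↓ 0`") of the
volume-ratio iteration in the proof of Perelman's no local collapsing theorem (Topping 2006,
proof of Thm. 8.3.1, p. 67 of the lecture notes: "When `m` is sufficiently large, this will
contradict the fact that the metric is smooth"), in the weak form that argument consumes
(`liminf_{r↓0} r⁻ⁿ V(p,r) > 0`).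

## Proof

Charts are locally bi-Lipschitz for the length distance (`VolumePositivity.lean`:
`exists_enorm_extChartAt_sub_le_mul_riemannianEDist`, the chart `φ` is `C₁`-Lipschitz near `x`;
`VolumeProofs.lean`: `exists_riemannianEDist_le_mul_edist_extChartAt`, `d ≤ C₂ ‖φ · - φ ·‖` near
`x`). Hence for `p` near `x` and small `r` the length ball `B_d(p, r)` contains the `φ`-preimage
`S` of the norm ball `B(φ p, r / C₂)`, whose image `φ '' S` is that whole norm ball (the chart image
of a neighbourhood is a neighbourhood, boundaryless case); Lipschitz maps expand `μH[n]` by at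
most `C₁ⁿ` (Federer 1969, §2.10.11), and `μH[n]` of the model space is an additive Haar measure,
so `μH[n] (B(z, s)) = sⁿ · μH[n] (B(0, 1))` with `0 < μH[n] (B(0,1)) < ∞`. Compactness: the
property "one pair `(c, ρ)` works on `A`" is stable under finite unions and holds near every point
(`IsCompact.induction_on`); radii `ρ < r ≤ R` are absorbed by monotonicity of balls.

## References

* I. Chavel, *Riemannian Geometry: A Modern Introduction*, 2nd ed., CUP 2006, §III.3
  (Riemannian measure in charts; volume `V(x;r)` of metric disks), Thm. III.4.2 (Günther–Bishop:
  `V(x;r) ≥ V_δ(r)` for small `r`, the sharp lower bound).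
* D. Burago, Yu. Burago, S. Ivanov, *A course in metric geometry*, AMS 2001, §5.1 (charts are
  locally bi-Lipschitz for the length metric).
* H. Federer, *Geometric Measure Theory*, Springer 1969, §2.10.11 (Lipschitz maps and `H^m`).
* P. Topping, *Lectures on the Ricci flow*, LMS Lecture Note Series 325, CUP 2006, §8.3, proof of
  Thm. 8.3.1 (use of `r⁻ⁿ V(p,r) → ω_n`).
-/

noncomputable section

open Manifold Bundle MeasureTheory Measure Set Filter Metric Module
open scoped ContDiff Topology ENNReal NNReal

namespace Literature.Geometry.Lorentzian

/-! ### An `ℝ≥0∞` bookkeeping lemma -/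

/-- From `a · w ≤ K · b` with `w` finite to `(K⁻¹ · w) · a ≤ b`, constants in `ℝ≥0`. [folklore] -/
theorem coe_inv_mul_toNNReal_mul_le {a b w : ℝ≥0∞} {K : ℝ≥0} (hK : K ≠ 0) (hw : w ≠ ⊤)
    (h : a * w ≤ K * b) : ((K⁻¹ * w.toNNReal : ℝ≥0) : ℝ≥0∞) * a ≤ b := by
  have hK' : (K : ℝ≥0∞) ≠ 0 := ENNReal.coe_ne_zero.2 hK
  calc ((K⁻¹ * w.toNNReal : ℝ≥0) : ℝ≥0∞) * a = (K : ℝ≥0∞)⁻¹ * (a * w) := by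
        rw [ENNReal.coe_mul, ENNReal.coe_inv hK, ENNReal.coe_toNNReal hw]; ring
    _ ≤ (K : ℝ≥0∞)⁻¹ * (K * b) := by gcongr
    _ = b := by rw [← mul_assoc, ENNReal.inv_mul_cancel hK' ENNReal.coe_ne_top, one_mul]

/-! ### Hausdorff measure of small length balls -/

section Hausdorff

variable {E : Type*} [NormedAddCommGroup E] [NormedSpace ℝ E]
  {H : Type*} [TopologicalSpace H] {I : ModelWithCorners ℝ E H}
  {M : Type*} [TopologicalSpace M] [ChartedSpace H M]
  [RiemannianBundle (fun x : M ↦ TangentSpace I x)]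
  [IsManifold I 1 M] [IsContinuousRiemannianBundle E (fun x : M ↦ TangentSpace I x)]

/-- **Small length balls have Hausdorff measure at least `c · rⁿ`, locally uniformly.** On a
boundaryless `C¹` manifold of dimension `n = dim E` whose tangent spaces carry a continuously
varying inner product, endowed with the length (e)metric `EMetricSpace.ofRiemannianMetric`, every
point `x` has a neighbourhood `V` with constants `c > 0`, `ρ > 0` such that
`c · rⁿ ≤ μH[n] (B(p, r))` for all `p ∈ V`, `0 < r ≤ ρ`. (Charts are locally bi-Lipschitz for the
length distance, Burago–Burago–Ivanov 2001, §5.1; Lipschitz maps and `μH[n]`, Federer 1969,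
§2.10.11; Haar scaling of balls in the model space. Sharp published form: the Günther–Bishop
comparison `V(x;r) ≥ V_δ(r)` for `r ≤ min {inj M, π/√δ}`, Chavel 2006, Thm. III.4.2.) [folklore] -/
theorem exists_nhds_mul_pow_le_hausdorffMeasure_eball [T3Space M] [MeasurableSpace M]
    [BorelSpace M] [I.Boundaryless] [FiniteDimensional ℝ E] (x : M) :
    letI := EMetricSpace.ofRiemannianMetric I M
    ∃ c : ℝ≥0, 0 < c ∧ ∃ ρ : ℝ, 0 < ρ ∧ ∃ V ∈ 𝓝 x, ∀ p ∈ V, ∀ r : ℝ, 0 < r → r ≤ ρ →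
      (c : ℝ≥0∞) * ENNReal.ofReal (r ^ finrank ℝ E) ≤
        μH[finrank ℝ E] (Metric.eball p (ENNReal.ofReal r)) := by
  letI := EMetricSpace.ofRiemannianMetric I M
  letI : MeasurableSpace E := borel E
  haveI : BorelSpace E := ⟨rfl⟩
  -- the chart `φ` at `x` is `C₁`-Lipschitz on `s₁ ∋ x`, its inverse `C₂`-Lipschitz on `s₂ ∋ x`
  obtain ⟨C₁, s₁, hs₁, h₁⟩ := exists_enorm_extChartAt_sub_le_mul_riemannianEDist (I := I) x
  obtain ⟨C₂, s₂, hs₂, -, -, h₂⟩ := exists_riemannianEDist_le_mul_edist_extChartAt (I := I) x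
  set φ := extChartAt I x with hφ
  set K₁ : ℝ≥0 := max C₁ 1 with hK₁
  set K₂ : ℝ≥0 := max C₂ 1 with hK₂
  have hK₁1 : (1 : ℝ≥0) ≤ K₁ := le_max_right _ _
  have hK₂1 : (1 : ℝ≥0) ≤ K₂ := le_max_right _ _
  have hK₂0 : (0 : ℝ) < K₂ := by exact_mod_cast zero_lt_one.trans_le hK₂1
  have hK₂ne : (K₂ : ℝ≥0∞) ≠ 0 := by exact_mod_cast (zero_lt_one.trans_le hK₂1).ne'
  set s := s₁ ∩ s₂ with hs_def
  have hs : s ∈ 𝓝 x := inter_mem hs₁ hs₂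
  have h₁' : ∀ y ∈ s, ∀ z ∈ s, edist (φ y) (φ z) ≤ K₁ * edist y z := by
    intro y hy z hz
    rw [edist_eq_enorm_sub]
    calc ‖φ y - φ z‖ₑ ≤ C₁ * riemannianEDist I y z := h₁ y hy.1 z hz.1
      _ ≤ K₁ * riemannianEDist I y z := by gcongr; exact le_max_left _ _
  have h₂' : ∀ y ∈ s, ∀ z ∈ s, edist y z ≤ K₂ * edist (φ y) (φ z) := by
    intro y hy z hz
    calc edist y z = riemannianEDist I y z := rfl
      _ ≤ C₂ * edist (φ y) (φ z) := h₂ y hy.2 z hz.2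
      _ ≤ K₂ * edist (φ y) (φ z) := by gcongr; exact le_max_left _ _
  -- the chart image of `s` contains a norm ball `B(φ x, ε)`
  obtain ⟨ε, hε, hεs⟩ : ∃ ε > 0, ball (φ x) ε ⊆ φ '' s :=
    Metric.mem_nhds_iff.1 (extChartAt_image_nhds_mem_nhds_of_boundaryless hs)
  -- the neighbourhood `V`, the radius bound `ρ`
  set V := s ∩ φ ⁻¹' ball (φ x) (ε / 2) with hV_def
  have hV : V ∈ 𝓝 x :=
    inter_mem hs ((continuousAt_extChartAt x).preimage_mem_nhds (ball_mem_nhds _ (half_pos hε)))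
  -- the Haar constant `w = μH[n] (B(0,1))` of the model space
  set w : ℝ≥0∞ := μH[finrank ℝ E] (ball (0 : E) 1) with hw_def
  have hw0 : w ≠ 0 := (measure_ball_pos (μH[finrank ℝ E]) (0 : E) one_pos).ne'
  have hwt : w ≠ ⊤ :=
    (measure_ball_lt_top (μ := (μH[finrank ℝ E] : Measure E)) (x := (0 : E)) (r := 1)).ne
  have hK : (K₁ * K₂) ^ finrank ℝ E ≠ 0 :=
    pow_ne_zero _ (mul_ne_zero (zero_lt_one.trans_le hK₁1).ne' (zero_lt_one.trans_le hK₂1).ne')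
  refine ⟨((K₁ * K₂) ^ finrank ℝ E)⁻¹ * w.toNNReal,
    mul_pos (inv_pos.2 (pos_iff_ne_zero.2 hK)) (ENNReal.toNNReal_pos hw0 hwt),
    K₂ * (ε / 2), mul_pos hK₂0 (half_pos hε), V, hV, fun p hp r hr hrρ ↦ ?_⟩
  apply coe_inv_mul_toNNReal_mul_le hK hwt
  -- the set `S = s ∩ φ⁻¹ B(φ p, r / K₂)` lies in the length ball `B(p, r)` ...
  have hrK : 0 < r / K₂ := div_pos hr hK₂0
  set S := s ∩ φ ⁻¹' ball (φ p) (r / K₂) with hS_def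
  have hSball : S ⊆ Metric.eball p (ENNReal.ofReal r) := by
    rintro y ⟨hys, hy⟩
    rw [Metric.mem_eball']
    have hy' : edist (φ p) (φ y) < ENNReal.ofReal (r / K₂) := by
      rw [edist_comm, edist_lt_ofReal]; exact hy
    calc edist p y ≤ K₂ * edist (φ p) (φ y) := h₂' p hp.1 y hys
      _ < K₂ * ENNReal.ofReal (r / K₂) := ENNReal.mul_lt_mul_right hK₂ne ENNReal.coe_ne_top hy'
      _ = ENNReal.ofReal r := by
          rw [← ENNReal.ofReal_coe_nnreal, ← ENNReal.ofReal_mul NNReal.zero_le_coe,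
            mul_div_cancel₀ _ hK₂0.ne']
  -- ... and its chart image is the whole norm ball `B(φ p, r / K₂)`
  have hballS : ball (φ p) (r / K₂) ⊆ φ '' S := by
    intro z hz
    have hzx : z ∈ ball (φ x) ε := by
      rw [mem_ball] at hz ⊢
      have hpx : dist (φ p) (φ x) < ε / 2 := hp.2
      have hrK₂ : r / K₂ ≤ ε / 2 := by
        rw [div_le_iff₀ hK₂0]; linarith [hrρ]
      calc dist z (φ x) ≤ dist z (φ p) + dist (φ p) (φ x) := dist_triangle _ _ _
        _ < ε / 2 + ε / 2 := add_lt_add (hz.trans_le hrK₂) hpx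
        _ = ε := add_halves ε
    obtain ⟨y, hys, rfl⟩ := hεs hzx
    exact ⟨y, ⟨hys, hz⟩, rfl⟩
  -- `φ` is `K₁`-Lipschitz on `S` for the length distance
  have hL : LipschitzOnWith K₁ φ S := fun y hy z hz ↦ h₁' y hy.1 z hz.1
  have hLH := hL.hausdorffMeasure_image_le (d := (finrank ℝ E : ℝ)) (Nat.cast_nonneg _)
  rw [ENNReal.rpow_natCast] at hLH
  -- Haar scaling in the model space
  have hHaar : μH[finrank ℝ E] (ball (φ p) (r / K₂)) =
      ENNReal.ofReal ((r / K₂) ^ finrank ℝ E) * w :=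
    addHaar_ball_of_pos _ _ hrK
  have hr_split : ENNReal.ofReal (r ^ finrank ℝ E) =
      (K₂ : ℝ≥0∞) ^ finrank ℝ E * ENNReal.ofReal ((r / K₂) ^ finrank ℝ E) := by
    rw [← ENNReal.ofReal_coe_nnreal, ← ENNReal.ofReal_pow NNReal.zero_le_coe,
      ← ENNReal.ofReal_mul (pow_nonneg NNReal.zero_le_coe _), ← mul_pow,
      mul_div_cancel₀ _ hK₂0.ne']
  calc ENNReal.ofReal (r ^ finrank ℝ E) * w
      = (K₂ : ℝ≥0∞) ^ finrank ℝ E * (ENNReal.ofReal ((r / K₂) ^ finrank ℝ E) * w) := by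
        rw [hr_split, mul_assoc]
    _ = (K₂ : ℝ≥0∞) ^ finrank ℝ E * μH[finrank ℝ E] (ball (φ p) (r / K₂)) := by rw [hHaar]
    _ ≤ (K₂ : ℝ≥0∞) ^ finrank ℝ E * μH[finrank ℝ E] (φ '' S) := by gcongr
    _ ≤ (K₂ : ℝ≥0∞) ^ finrank ℝ E * ((K₁ : ℝ≥0∞) ^ finrank ℝ E * μH[finrank ℝ E] S) := by
        gcongr
    _ ≤ (K₂ : ℝ≥0∞) ^ finrank ℝ E *
          ((K₁ : ℝ≥0∞) ^ finrank ℝ E * μH[finrank ℝ E] (Metric.eball p (ENNReal.ofReal r))) := by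
        gcongr
    _ = (((K₁ * K₂) ^ finrank ℝ E : ℝ≥0) : ℝ≥0∞) *
          μH[finrank ℝ E] (Metric.eball p (ENNReal.ofReal r)) := by
        push_cast; ring

/-- **Uniform lower volume bound for balls centred on a compact set.** In the setting of
`exists_nhds_mul_pow_le_hausdorffMeasure_eball`, for every compact `K ⊆ M` and every `R` there is
`c > 0` with `c · rⁿ ≤ μH[n] (B(p, r))` for all `p ∈ K` and all `0 < r ≤ R` (finitely many of the
local bounds, and monotonicity of balls in the radius for `ρ < r ≤ R`). [folklore] -/
theorem exists_mul_pow_le_hausdorffMeasure_eball_of_isCompact [T3Space M] [MeasurableSpace M]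
    [BorelSpace M] [I.Boundaryless] [FiniteDimensional ℝ E] {K : Set M} (hK : IsCompact K)
    (R : ℝ) :
    letI := EMetricSpace.ofRiemannianMetric I M
    ∃ c : ℝ≥0, 0 < c ∧ ∀ p ∈ K, ∀ r : ℝ, 0 < r → r ≤ R →
      (c : ℝ≥0∞) * ENNReal.ofReal (r ^ finrank ℝ E) ≤
        μH[finrank ℝ E] (Metric.eball p (ENNReal.ofReal r)) := by
  letI := EMetricSpace.ofRiemannianMetric I M
  -- Step 1: a pair `(c, ρ)` valid on all of `K`, by compactness
  have hloc : ∃ c : ℝ≥0, 0 < c ∧ ∃ ρ : ℝ, 0 < ρ ∧ ∀ p ∈ K, ∀ r : ℝ, 0 < r → r ≤ ρ →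
      (c : ℝ≥0∞) * ENNReal.ofReal (r ^ finrank ℝ E) ≤
        μH[finrank ℝ E] (Metric.eball p (ENNReal.ofReal r)) := by
    refine hK.induction_on (p := fun A ↦ ∃ c : ℝ≥0, 0 < c ∧ ∃ ρ : ℝ, 0 < ρ ∧ ∀ p ∈ A,
      ∀ r : ℝ, 0 < r → r ≤ ρ → (c : ℝ≥0∞) * ENNReal.ofReal (r ^ finrank ℝ E) ≤
        μH[finrank ℝ E] (Metric.eball p (ENNReal.ofReal r))) ?_ ?_ ?_ ?_
    · exact ⟨1, one_pos, 1, one_pos, fun p hp ↦ hp.elim⟩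
    · intro s t hst ht
      obtain ⟨c, hc, ρ, hρ, h⟩ := ht
      exact ⟨c, hc, ρ, hρ, fun p hp ↦ h p (hst hp)⟩
    · intro s t hs ht
      obtain ⟨c, hc, ρ, hρ, h⟩ := hs
      obtain ⟨c', hc', ρ', hρ', h'⟩ := ht
      refine ⟨min c c', lt_min hc hc', min ρ ρ', lt_min hρ hρ', fun p hp r hr hrρ ↦ ?_⟩
      rcases hp with hp | hp
      · calc ((min c c' : ℝ≥0) : ℝ≥0∞) * ENNReal.ofReal (r ^ finrank ℝ E)
            ≤ (c : ℝ≥0∞) * ENNReal.ofReal (r ^ finrank ℝ E) := by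
              gcongr; exact min_le_left _ _
          _ ≤ _ := h p hp r hr (hrρ.trans (min_le_left _ _))
      · calc ((min c c' : ℝ≥0) : ℝ≥0∞) * ENNReal.ofReal (r ^ finrank ℝ E)
            ≤ (c' : ℝ≥0∞) * ENNReal.ofReal (r ^ finrank ℝ E) := by
              gcongr; exact min_le_right _ _
          _ ≤ _ := h' p hp r hr (hrρ.trans (min_le_right _ _))
    · intro x _
      obtain ⟨c, hc, ρ, hρ, V, hV, h⟩ := exists_nhds_mul_pow_le_hausdorffMeasure_eball (I := I) x
      exact ⟨V, mem_nhdsWithin_of_mem_nhds hV, c, hc, ρ, hρ, h⟩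
  -- Step 2: radii `ρ < r ≤ R` by monotonicity
  obtain ⟨c, hc, ρ, hρ, h⟩ := hloc
  rcases le_or_gt R ρ with hR | hR
  · exact ⟨c, hc, fun p hp r hr hrR ↦ h p hp r hr (hrR.trans hR)⟩
  have hρR : 0 < ρ / R := div_pos hρ (hρ.trans hR)
  have hq : (0 : ℝ≥0) < ⟨ρ / R, hρR.le⟩ ^ finrank ℝ E := pow_pos hρR _
  refine ⟨c * ⟨ρ / R, hρR.le⟩ ^ finrank ℝ E, mul_pos hc hq, fun p hp r hr hrR ↦ ?_⟩
  rcases le_or_gt r ρ with hrρ | hrρ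
  · calc ((c * ⟨ρ / R, hρR.le⟩ ^ finrank ℝ E : ℝ≥0) : ℝ≥0∞) * ENNReal.ofReal (r ^ finrank ℝ E)
        ≤ (c : ℝ≥0∞) * ENNReal.ofReal (r ^ finrank ℝ E) := by
          gcongr
          exact mul_le_of_le_one_right c.2 (pow_le_one₀ hρR.le ((div_le_one (hρ.trans hR)).2 hR.le))
      _ ≤ _ := h p hp r hr hrρ
  · -- `ρ < r ≤ R`: compare with the ball of radius `ρ`
    have hmono : Metric.eball p (ENNReal.ofReal ρ) ⊆ Metric.eball p (ENNReal.ofReal r) :=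
      Metric.eball_subset_eball (ENNReal.ofReal_le_ofReal hrρ.le)
    calc ((c * ⟨ρ / R, hρR.le⟩ ^ finrank ℝ E : ℝ≥0) : ℝ≥0∞) * ENNReal.ofReal (r ^ finrank ℝ E)
        = (c : ℝ≥0∞) * ENNReal.ofReal ((ρ / R) ^ finrank ℝ E * r ^ finrank ℝ E) := by
          rw [ENNReal.ofReal_mul (pow_nonneg hρR.le _), ENNReal.coe_mul, mul_assoc]
          congr 1
          rw [ENNReal.coe_pow, ← ENNReal.ofReal_coe_nnreal, ENNReal.ofReal_pow hρR.le]
          rfl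
      _ ≤ (c : ℝ≥0∞) * ENNReal.ofReal (ρ ^ finrank ℝ E) := by
          gcongr
          rw [← mul_pow]
          apply pow_le_pow_left₀ (mul_nonneg hρR.le hr.le)
          calc ρ / R * r ≤ ρ / R * R := by gcongr
            _ = ρ := div_mul_cancel₀ _ (hρ.trans hR).ne'
      _ ≤ μH[finrank ℝ E] (Metric.eball p (ENNReal.ofReal ρ)) := h p hp ρ hρ le_rfl
      _ ≤ μH[finrank ℝ E] (Metric.eball p (ENNReal.ofReal r)) := measure_mono hmono

end Hausdorff

/-! ### Riemannian volume of small balls (`Volume.lean` vocabulary) -/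

section Volume

variable {E : Type*} [NormedAddCommGroup E] [NormedSpace ℝ E]
  {H : Type*} [TopologicalSpace H] {I : ModelWithCorners ℝ E H} {n : ℕ∞ω}
  {N : Type*} [TopologicalSpace N] [ChartedSpace H N] [IsManifold I 1 N] [T3Space N]
  [MeasurableSpace N] [BorelSpace N]

/-- Bookkeeping: `riemannianVolume h d` is the nonzero multiple `μHE[d] = σ_d • μH[d]` of the
Hausdorff measure of the length metric, so a lower bound `c · r^d ≤ μH[d] (B(p, r))` becomes
`(σ_d c) · r^d ≤ Vol_h {y | d_h(p, y) < r}`. [folklore] -/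
theorem ofReal_mul_pow_le_riemannianVolume_setOf_lt
    (h : ContMDiffRiemannianMetric I n E (TangentSpace I : N → Type _)) {d : ℕ} {c : ℝ≥0}
    {p : N} {r : ℝ}
    (hle : letI : RiemannianBundle (fun x : N ↦ TangentSpace I x) :=
        ⟨h.toContinuousRiemannianMetric.toRiemannianMetric⟩
      letI := EMetricSpace.ofRiemannianMetric I N
      (c : ℝ≥0∞) * ENNReal.ofReal (r ^ d) ≤ μH[d] (Metric.eball p (ENNReal.ofReal r))) :
    ENNReal.ofReal
        (((addHaarScalarFactor (volume : Measure (EuclideanSpace ℝ (Fin d)))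
            (μH[d] : Measure (EuclideanSpace ℝ (Fin d))) * c : ℝ≥0) : ℝ) * r ^ d) ≤
      riemannianVolume h d
        {y | (letI : RiemannianBundle (fun x : N ↦ TangentSpace I x) :=
          ⟨h.toContinuousRiemannianMetric.toRiemannianMetric⟩;
          riemannianEDist I p y) < ENNReal.ofReal r} := by
  letI : RiemannianBundle (fun x : N ↦ TangentSpace I x) :=
    ⟨h.toContinuousRiemannianMetric.toRiemannianMetric⟩
  letI := EMetricSpace.ofRiemannianMetric I N
  have hball : {y | riemannianEDist I p y < ENNReal.ofReal r} =
      Metric.eball p (ENNReal.ofReal r) := by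
    ext y; rw [Metric.mem_eball']; rfl
  show _ ≤ (μHE[d] : Measure N) _
  rw [hball, Measure.euclideanHausdorffMeasure_def, Measure.smul_apply, ENNReal.smul_def,
    smul_eq_mul, ENNReal.ofReal_mul NNReal.zero_le_coe, ENNReal.ofReal_coe_nnreal, ENNReal.coe_mul,
    mul_assoc]
  gcongr

/-- **Small geodesic balls have volume at least `c · rⁿ`, locally uniformly** (`Volume.lean`
vocabulary): for a `C^k` Riemannian metric `h` on a boundaryless manifold `N` of dimension
`n = dim E` and every `x : N` there are `c > 0`, `ρ > 0` and a neighbourhood `V` of `x` with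
`c · rⁿ ≤ Vol_h {y | d_h(p, y) < r}` for all `p ∈ V`, `0 < r ≤ ρ`; here `d_h` is the length
distance of `h` (`riemannianEDist` for the Riemannian bundle structure of `h`) and
`Vol_h = riemannianVolume h (dim E) = riemannianMeasure h`. In particular
`liminf_{r↓0} r⁻ⁿ Vol_h B(p, r) > 0` at every point (sharp form: Günther–Bishop, Chavel 2006,
Thm. III.4.2, whence the limit is `ω_n`). [folklore] -/
theorem exists_nhds_mul_pow_le_riemannianVolume [I.Boundaryless] [FiniteDimensional ℝ E]
    (h : ContMDiffRiemannianMetric I n E (TangentSpace I : N → Type _)) (x : N) :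
    ∃ c : ℝ, 0 < c ∧ ∃ ρ : ℝ, 0 < ρ ∧ ∃ V ∈ 𝓝 x, ∀ p ∈ V, ∀ r : ℝ, 0 < r → r ≤ ρ →
      ENNReal.ofReal (c * r ^ finrank ℝ E) ≤ riemannianVolume h (finrank ℝ E)
        {y | (letI : RiemannianBundle (fun x : N ↦ TangentSpace I x) :=
          ⟨h.toContinuousRiemannianMetric.toRiemannianMetric⟩;
          riemannianEDist I p y) < ENNReal.ofReal r} := by
  letI : RiemannianBundle (fun x : N ↦ TangentSpace I x) :=
    ⟨h.toContinuousRiemannianMetric.toRiemannianMetric⟩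
  letI := EMetricSpace.ofRiemannianMetric I N
  obtain ⟨c, hc, ρ, hρ, V, hV, hle⟩ := exists_nhds_mul_pow_le_hausdorffMeasure_eball (I := I) x
  have hσ := addHaarScalarFactor_volume_hausdorffMeasure_ne_zero (finrank ℝ E)
  exact ⟨_, NNReal.coe_pos.2 (mul_pos (pos_iff_ne_zero.2 hσ) hc), ρ, hρ, V, hV,
    fun p hp r hr hrρ ↦ ofReal_mul_pow_le_riemannianVolume_setOf_lt h (hle p hp r hr hrρ)⟩

/-- **Uniform lower volume bound on a compact set** (`Volume.lean` vocabulary): for a `C^k`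
Riemannian metric `h` on a boundaryless manifold `N` of dimension `n = dim E`, a compact
`K ⊆ N` and any `R`, there is `c > 0` with `c · rⁿ ≤ Vol_h {y | d_h(p, y) < r}` for all `p ∈ K`
and all `0 < r ≤ R`. [folklore] -/
theorem exists_mul_pow_le_riemannianVolume_of_isCompact [I.Boundaryless] [FiniteDimensional ℝ E]
    (h : ContMDiffRiemannianMetric I n E (TangentSpace I : N → Type _)) {K : Set N}
    (hK : IsCompact K) (R : ℝ) :
    ∃ c : ℝ, 0 < c ∧ ∀ p ∈ K, ∀ r : ℝ, 0 < r → r ≤ R →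
      ENNReal.ofReal (c * r ^ finrank ℝ E) ≤ riemannianVolume h (finrank ℝ E)
        {y | (letI : RiemannianBundle (fun x : N ↦ TangentSpace I x) :=
          ⟨h.toContinuousRiemannianMetric.toRiemannianMetric⟩;
          riemannianEDist I p y) < ENNReal.ofReal r} := by
  letI : RiemannianBundle (fun x : N ↦ TangentSpace I x) :=
    ⟨h.toContinuousRiemannianMetric.toRiemannianMetric⟩
  letI := EMetricSpace.ofRiemannianMetric I N
  obtain ⟨c, hc, hle⟩ := exists_mul_pow_le_hausdorffMeasure_eball_of_isCompact (I := I) hK R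
  have hσ := addHaarScalarFactor_volume_hausdorffMeasure_ne_zero (finrank ℝ E)
  exact ⟨_, NNReal.coe_pos.2 (mul_pos (pos_iff_ne_zero.2 hσ) hc),
    fun p hp r hr hrR ↦ ofReal_mul_pow_le_riemannianVolume_setOf_lt h (hle p hp r hr hrR)⟩

/-- **Closed manifolds: geodesic balls of radius `≤ R` have volume `≥ c · rⁿ`.** For a `C^k`
Riemannian metric `h` on a compact boundaryless manifold `N` of dimension `n = dim E` and every
`R` there is `c > 0` such that `c · rⁿ ≤ Vol_h {y | d_h(p, y) < r}` for all `p` and all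
`0 < r ≤ R` (the qualitative content of `r⁻ⁿ V(p,r) → ω_n`, Chavel 2006, §III.3 and Thm. III.4.2,
uniformly on a compact manifold — the form used in the volume-ratio iteration of Topping 2006,
proof of Thm. 8.3.1). [folklore] -/
theorem exists_mul_pow_le_riemannianVolume_of_compactSpace [I.Boundaryless]
    [FiniteDimensional ℝ E] [CompactSpace N]
    (h : ContMDiffRiemannianMetric I n E (TangentSpace I : N → Type _)) (R : ℝ) :
    ∃ c : ℝ, 0 < c ∧ ∀ (p : N) (r : ℝ), 0 < r → r ≤ R →
      ENNReal.ofReal (c * r ^ finrank ℝ E) ≤ riemannianVolume h (finrank ℝ E)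
        {y | (letI : RiemannianBundle (fun x : N ↦ TangentSpace I x) :=
          ⟨h.toContinuousRiemannianMetric.toRiemannianMetric⟩;
          riemannianEDist I p y) < ENNReal.ofReal r} := by
  obtain ⟨c, hc, hle⟩ :=
    exists_mul_pow_le_riemannianVolume_of_isCompact (I := I) h (isCompact_univ (X := N)) R
  exact ⟨c, hc, fun p r hr hrR ↦ hle p (mem_univ p) r hr hrR⟩

end Volume

end Literature.Geometry.Lorentzian

end
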